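import Mathlib.LinearAlgebra.Matrix.Rank
import Mathlib.Data.Nat.PrimeFin
import Literature.NumberTheory.QuadraticForms.PadicHilbertSymbol
import Literature.NumberTheory.EllipticCurves.BSDAnalyticRank
import Literature.NumberTheory.EllipticCurves.Selmer
import HarnessLib

/-!
# Aoki 1999, *On the 2-Selmer groups of elliptic curves arising from the congruent number problem*,
# Theorem 2.2 AS PRINTED: a closed formula for `dim_{𝔽₂} Sel^(2)(E^(n)/ℚ)`, `E^(n) : y² = x³ − n²x`

HONEST FRAMING (cell `bsd-monsky`, run/shared/lean/pub/bsd-monsky/, prover-A g6): this file vendors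
ONE refereed, completely proved published theorem as a named `Prop` — nothing asserted, nothing
discharged (D-0014) — together with the COMPUTABLE data it speaks about (definitions with bodies:
finite sets of primes, additive Hilbert symbols, `𝔽₂`-matrices) and a few PROVED pieces of
bookkeeping (evaluation of the additive symbol by Serre's explicit local sign, bimultiplicativity). It is the first source in the tree in which the exact value
`#Sel₂(E_{2pq}/ℚ) = 8` on the cell's family follows from a FULLY PRINTED proof: the tree's other
input for the same quantity, `HeathBrown1994.monsky_card_selmerGroup_two_even` (Monsky's appendix
to Heath-Brown 1994), prints its even case only as "a sketch proof". The family evaluation lives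
on the summit side (`Summits/BirchSwinnertonDyer/Rank1Residual/P2/…SelmerEightAoki.lean`).

Source. N. Aoki, *On the 2-Selmer groups of elliptic curves arising from the congruent number
problem*, Comment. Math. Univ. St. Pauli **48** (1999), no. 1, 77–101 [Aoki1999] (DOI
10.14992/00009867; refereed journal article; "The purpose of this paper is to give an explicit
formula for the size of `Sel^(2)(E^(n)/ℚ)` (Theorem 2.2)", p. 77). Statements re-read on the page
images (cell holding `lit/aux/aoki1999-cmusp48/`, 150 dpi renders of pp. 79–81, 86–87, 98).

## The printed statements (verbatim)

* p. 78 (§1): "Throughout this paper we fix a (possibly negative) square-free integer `n`.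
  `E^(n) : y² = x³ − n²x`, `E′^(n) : y² = x³ + 4n²x`." p. 79: "`Sel^(2)(E/ℚ) = {ξ ∈ H¹(ℚ, E[2]) |
  res_p(ξ) ∈ δ_p(E(ℚ_p)) (∀p ∈ M)}`" (`M` = the places of `ℚ`).
* p. 79 (§2): "Let `( , )_p : ℚ_p^× × ℚ_p^× → {±1}` be the Hilbert symbol of `ℚ_p`. For
  `a, b ∈ ℚ_p^×`, let us define `{a, b}_p ∈ ℤ/2ℤ` by the rule `(−1)^{{a,b}_p} = (a, b)_p`. For any
  prime `p` and `x ∈ ℚ_p^×` let `λ_p(x) = {−n, x}_p` if `p ≠ 2`, `{2, x}_2` if `p = 2`. For two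
  finite subsets `X = {p₁, ⋯, p_r}` and `Y = {q₁, ⋯, q_s}` of prime numbers with ordinary ordering,
  we define an `r × s` matrix `Λ_{X,Y} ∈ M_{r,s}(ℤ/2ℤ)` by `Λ_{X,Y} = (λ_{q_j}(p_i))_{1≤i≤r, 1≤j≤s}`."
* p. 80: "Let `S` be the set of the primes dividing `n` and `T₁` the subset of `S` consisting of
  primes `p` such that `p ≡ 1 (mod 4)`. Moreover, we let `T = T₁ ∪ {2}` if `n ≡ ±1 (mod 8)`,
  `T = T₁` if `n ≢ ±1 (mod 8)`."
* p. 80, THEOREM 2.1: "`dim Sel^(φ′)(E′/ℚ) = 1 + |S| − rank Λ_{S,T}`, `dim Sel^(φ)(E/ℚ) = |T| − rank Λ_{T,S}`."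
* p. 80: "Let `X = {p₁, ⋯, p_s}` be a finite set of prime numbers. Let `Δ_X ∈ M_s(ℤ/2ℤ)` be the
  diagonal matrix whose `(i, i)`-entry is `λ₂(p_i)`. Moreover, let `Ω_X = (ω_{ij}) ∈ M_s(ℤ/2ℤ)` be
  the symmetric matrix whose `(i, j)`-entry is defined by `ω_{ij} = 0` if `i = j`,
  `ε₂(p_i)λ₂(p_j) + λ₂(p_i)ε₂(p_j)` if `i ≠ j`, where `e₂(p) = 0` or `1` according as `p ≡ 1` or
  `3 (mod 4)`. Let `V_X` be the subgroup of `ℚ^×/ℚ^{×2}` generated by the images of `p₁, ⋯, p_s`.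
  … `v_X : V_X → (ℤ/2ℤ)^s` … the isomorphism defined by `v_X(x) = (v_{p₁}(x), ⋯, v_{p_s}(x))`
  (`v_p(x)` = the parity of `ord_p(x)`). We define “the essential part” of `Sel^(φ′)(E′/ℚ)` by:
  `Sel₀^(φ′)(E′/ℚ) = {x ∈ S^(φ′)(E′/ℚ) | x > 0, x ≡ 1 (mod 8)}` if `n ≡ ±1 (mod 8)`,
  `{x ∈ S^(φ′)(E′/ℚ) | x > 0, x ≡ ±1 (mod 8)}` if `n ≡ ±5 (mod 8)`,
  `{x ∈ S^(φ′)(E′/ℚ) | x > 0, v₂(x) = 0}` if `n ≡ ±2 (mod 8)`. Clearly `Sel₀^(φ′)(E′/ℚ)` is a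
  subgroup of `Sel^(φ′)(E′/ℚ)` … It is easy to see that the group `Sel₀^(φ′)(E′/ℚ)` is a subspace
  of `V_{S₁}`. Let `r = dim Sel₀^(φ′)(E′/ℚ)` and `{x₁, ⋯, x_r}` a basis of
  `v_{S₁}(Sel₀^(φ′)(E′/ℚ))`. Let `s = |S₁|`. We define an `r × s` matrix by `Φ = (x₁; ⋯; x_r)`."
  (`S₁` = "the set of odd primes dividing `n`", p. 93, Theorem 6.1.)
* p. 81, THEOREM 2.2: "Let `S₂ = S₁ ∖ T`. Then we have
  `dim Sel^(2)(E/ℚ) = 1 + |S| + |T| − 2 rank Λ_{S,T} − rank ᵗΦ(ᵗΛ_{S₂,S₁}Λ_{S₂,S₁} + Δ_{S₁} + νΩ_{S₁})Φ`,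
  where `ν = 0` or `1` according as `n` is odd or even."
* p. 93, THEOREM 6.1: "Assume that `n ≡ 3, 6` or `7 (mod 8)`. Let `z, z′ ∈ Ш(E′/ℚ)[φ′]` and
  `x, x′ ∈ Sel₀^(φ′)(E′/ℚ)` any lifts of `z, z′` respectively. Then we have
  `⟨z, z′⟩_φ′ = Σ_{p∈S₁} {ε₂(p)λ_p(x)λ_p(x′) + λ₂(p)v_p(x)v_p(x′)} + (0 if n is odd; ε₂(x)λ₂(x′) + ε₂(x′)λ₂(x) if n is even)`,
  where `S₁` denotes the set of odd primes dividing `n`. The assumption on `n` makes no loss of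
  generality since `E′^(n) = E′^(−n)`."
* p. 98 (proof of Theorem 2.2): "Let `V = V_{S₁}`. We define an inner product `( , )_V` on `V` by
  `(x, x′)_V = Σ_{l∈S₁} {ε₂(l)λ_l(x)λ_l(x′) + λ₂(l)v_l(x)v_l(x′)} + ν{λ₂(x)ε₂(x′) + ε₂(x)λ₂(x′)}`, where
  `ν = 0` if `n` is odd and `ν = 1` if `n` is even. Theorem 6.1 then implies that the pairing `⟨ , ⟩_φ′`
  is the restriction of `( , )_V` to the subspace `Sel₀^(φ′)(E′/ℚ)` of `V`. If `p, q` are odd prime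
  factors of `n`, then `(p, q)_V = … = Σ_{l∈S₂} λ_l(p)λ_l(q) + δ_{p,q}λ₂(p) + ν{λ₂(p)ε₂(q) + ε₂(p)λ₂(q)}`,
  where `S₂ = S₁ ∖ T₁` and `δ_{p,q}` denotes Kronecker's delta. Thus, if `S₁ = {p₁, ⋯, p_s}`, then
  `(p_i, p_j)_V` is the `(i, j)`-entry of the matrix `ᵗΛ_{S₂,S₁}Λ_{S₂,S₁} + Δ_{S₁} + νΩ_{S₁}`. …
  `rank ⟨ , ⟩_φ′ = rank ᵗΦ(ᵗΛ_{S₂,S₁}Λ_{S₂,S₁} + Δ_{S₁} + νΩ_{S₁})Φ`. This proves the theorem."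
* p. 86–87 (§4): "`U_X = {x ∈ ℚ^× | ord_p(x) = 0 for any prime p ∉ X, and x > 0 if ∞ ∉ X}`",
  "`V_X = U_X ℚ^{×2}/ℚ^{×2} ≅ U_X/U_X²`", "`λ_{X,Y} : V_X → (ℤ/2ℤ)^s`, `λ_{X,Y}(x) = (λ_{q₁}(x), ⋯, λ_{q_s}(x))`";
  THEOREM 4.1: "Let `S, T` be as in Theorem 2.1. Then `Sel^(φ′)(E′/ℚ)` (resp. `S^(φ)(E/ℚ)`) is a
  subgroup of `V_{S∪{∞}}` (resp. `V_T`), and we have `S^(φ′)(E′/ℚ) = ⟨−1⟩ ker λ_{S,T}`,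
  `S^(φ)(E/ℚ) = ker λ_{T,S}`." (proof p. 87: "`V_S ∩ Sel^(φ′)(E′/ℚ) = Ker λ_{S,T}`").

## Transcription (tree dictionary) and the two elementary substitutions

* `E^(n)` for `n ≥ 1` is the tree's `congruentNumberCurve n`; "`Sel^(2)(E/ℚ)`" is the tree's
  `2`-Selmer group `(congruentNumberCurve n).selmerGroup 2 ⊆ H¹(ℚ, E[2])` (`Selmer.lean`, the same
  object as in `HeathBrown1994.monsky_card_selmerGroup_two_even`); "`dim_{𝔽₂} Sel^(2) = d`" is
  rendered as `Nat.card (… .selmerGroup 2) = 2 ^ d` (it is an `𝔽₂`-vector space).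
  TODO(general form): the paper allows negative square-free `n` (`E^(−n)` is the twist by `−1`); the
  tree's curve takes `n : ℕ`, so only `n ≥ 1` is typed.
* "the Hilbert symbol of `ℚ_p`" is the tree's `hilbertSymbol ℚ_[p]` (O'Meara §63B definition on
  Mathlib's `ℚ_[p]`); `{a, b}_p` is `hilbertBit p a b` (`0` if the symbol is `1`, else `1`), whose
  value on non-zero integers is Serre's explicit sign `localSign p a b`
  (`hilbertSymbol_padic_intCast`, Serre Ch. III Thm. 1) — `hilbertBit_eq_of_localSign`.
* `S, T₁, T, S₁, S₂` are the `Finset ℕ`s `sSet n` (= `n.primeFactors`), `tOneSet n`, `tSet n`,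
  `sOneSet n`, `sTwoSet n`; a matrix "indexed by the primes of `X` in ordinary ordering" is typed
  as `Matrix X Y (ZMod 2)` on the subtypes `↥X`, `↥Y` (a re-ordering conjugates by permutation
  matrices and changes no rank); `rank` is Mathlib's `Matrix.rank` over the field `ZMod 2`.
* `λ_p(x)` is `lam n p x` (the junk value `0` for non-prime `p` is never reached: every index
  is a prime of `S` or `2`).
* SUBSTITUTION 1 (Theorem 4.1 of the same paper, proved in full in its §3–§4): the set
  `Sel₀^(φ′)(E′/ℚ)` is described through "`x ∈ S^(φ′)(E′/ℚ)`", which Theorem 4.1 identifies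
  inside `V_{S∪{∞}} = ⟨−1⟩V_S` as `⟨−1⟩ ker λ_{S,T}`; a POSITIVE `x` therefore lies in `S^(φ′)` iff
  `x ∈ V_S` and `λ_q(x) = 0` for all `q ∈ T`. With the printed 2-adic conditions this makes
  `v_{S₁}(Sel₀^(φ′)(E′/ℚ))` the explicit set `essential n ⊆ 𝔽₂^{S₁}`: the `w` whose positive
  representative `x_w = ∏_{p ∈ S₁} p^{w_p}` (`rep n w`, the inverse of `v_{S₁}`) satisfies
  `λ_q(x_w) = 0` for all `q ∈ T` and `essentialCond n x_w`.
* THE GRAM MATRIX is typed from the p. 98 display `(p, q)_V = Σ_{l∈S₂} λ_l(p)λ_l(q) + δ_{p,q}λ₂(p) +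
  ν{…}` (`gramMatrix n`), i.e. with the symbols taken AT the primes `l ∈ S₂` OF `p, q`, as Theorem 6.1
  gives them; in the convention `Λ_{X,Y} = (λ_{q_j}(p_i))` of p. 80 this is `Λ_{S₁,S₂}·ᵗΛ_{S₁,S₂} + Δ + νΩ`,
  while the statement prints `ᵗΛ_{S₂,S₁}Λ_{S₂,S₁}` (entries `Σ_l λ_p(l)λ_q(l)`); the two differ only by
  `λ_l(p) ↔ λ_p(l)`, which is an identity unless `l ≡ p ≡ 3 (mod 4)` (quadratic reciprocity), and
  coincide on every `n` with `|S₂| = 1` (the cell's family `n = 2pq`).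
* THE RANGE `n ≡ 3, 6, 7 (mod 8)`: the proof applies Theorem 6.1 (stated for these residues) to `n`
  itself; for `n ≡ 1, 2, 5 (mod 8)` the paper passes to `−n` (same curves `E`, `E′`), which replaces
  `λ_p(x) = {−n, x}_p` by `{n, x}_p`; the named fact is typed on the range where no sign change enters.
  TODO(general form): the other residues (via `n ↦ −n`).
* SUBSTITUTION 2 (linear algebra): the printed `rank ᵗΦ G Φ`, `Φ` a basis (as rows) of the subspace
  `W = v_{S₁}(Sel₀)`, is the rank of the bilinear form `G` restricted to `W`; it equals the rank of the
  Gram matrix `(wᵀ G w′)_{w, w′ ∈ W}` over ALL elements of `W`: writing every `w ∈ W` in the basis,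
  that matrix is `C (Φ G Φᵀ) Cᵀ` with `C` (`|W| × r`) the coordinate matrix, of full column rank `r`
  (it contains the identity rows), and multiplying by an injective matrix on the left and its transpose
  on the right preserves the rank. The tree types the basis-free matrix (`gramEssential n`). (Aoki
  prints `ᵗΦ(…)Φ` with `Φ ∈ M_{r,s}`, p. 81; the proof p. 98 writes the form in coordinates as
  `x′Φ(…)ᵗΦᵗx″`, i.e. `Φ(…)ᵗΦ`; the rank is the same.)

No `_holds` is expected here (the proof is a complete `2`-descent with the local analysis of
Aoki §3 and the Cassels pairing of §5–§7); consumers take `(h : thm22_card_selmerGroup_two)`.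

## References
* [Aoki1999] N. Aoki, Comment. Math. Univ. St. Pauli 48 (1999) 77–101: §1 pp. 78–79, §2 pp. 79–81
  (Theorems 2.1, 2.2, Corollaries 2.3, 2.4), §4 pp. 86–87 (Theorem 4.1), §7 p. 98 (proof of 2.2).
* [Serre1973] J.-P. Serre, *A Course in Arithmetic*, Ch. III §1.2 Thm. 1 (explicit Hilbert symbol
  of `ℚ_p`), the tree's `hilbertSymbol_padic_intCast`.
* [Omeara1963] O. T. O'Meara, *Introduction to quadratic forms*, §63B (the Hilbert symbol).
-/

noncomputable section

open scoped Classical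

open Matrix WeierstrassCurve Literature.NumberTheory.QuadraticForms

namespace Literature.NumberTheory.EllipticCurves.Aoki1999

/-! ### §1 The additive Hilbert symbol `{a, b}_p` and Aoki's `λ_p` -/

/-- The additive Hilbert symbol `{a, b}_p ∈ ℤ/2ℤ` of `ℚ_p`, "defined by the rule
`(−1)^{{a,b}_p} = (a, b)_p`" (p. 79): `0` if the Hilbert symbol `(a, b)_{ℚ_p}` of the two integers
`a, b` (the tree's `hilbertSymbol ℚ_[p]`) is `1`, and `1` otherwise.
[cite: Aoki1999, §2 p. 79] -/
def hilbertBit (p : ℕ) [Fact p.Prime] (a b : ℤ) : ZMod 2 :=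
  if hilbertSymbol ℚ_[p] (a : ℚ_[p]) (b : ℚ_[p]) = 1 then 0 else 1

/-- Aoki's `λ_p(x)`: "`λ_p(x) = {−n, x}_p` if `p ≠ 2`, `{2, x}_2` if `p = 2`" (p. 79), on integers
`x`, for the curve `E^(n)`. Value `0` when `p` is not prime (never used: the indices are primes).
[cite: Aoki1999, §2 p. 79] -/
def lam (n : ℕ) (p : ℕ) (x : ℤ) : ZMod 2 :=
  if hp : p.Prime then
    haveI := Fact.mk hp
    if p = 2 then hilbertBit 2 2 x else hilbertBit p (-(n : ℤ)) x
  else 0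

/-- `ε₂(p)` ("`e₂(p) = 0` or `1` according as `p ≡ 1` or `3 (mod 4)`", p. 80), on odd primes.
[cite: Aoki1999, §2 p. 80] -/
def epsTwo (p : ℕ) : ZMod 2 := if p % 4 = 1 then 0 else 1

/-- `ν = 0` or `1` according as `n` is odd or even (Theorem 2.2, p. 81).
[cite: Aoki1999, Thm. 2.2 p. 81] -/
def nu (n : ℕ) : ZMod 2 := if n % 2 = 0 then 1 else 0

/-! ### §2 The sets of primes `S, T₁, T, S₁, S₂` -/

/-- `S`: "the set of the primes dividing `n`" (p. 80). [cite: Aoki1999, §2 p. 80] -/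
def sSet (n : ℕ) : Finset ℕ := n.primeFactors

/-- `T₁`: "the subset of `S` consisting of primes `p` such that `p ≡ 1 (mod 4)`" (p. 80).
[cite: Aoki1999, §2 p. 80] -/
def tOneSet (n : ℕ) : Finset ℕ := (sSet n).filter fun p => p % 4 = 1

/-- `T`: "`T = T₁ ∪ {2}` if `n ≡ ±1 (mod 8)`, `T = T₁` if `n ≢ ±1 (mod 8)`" (p. 80).
[cite: Aoki1999, §2 p. 80] -/
def tSet (n : ℕ) : Finset ℕ :=
  if n % 8 = 1 ∨ n % 8 = 7 then insert 2 (tOneSet n) else tOneSet n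

/-- `S₁`: "the set of odd primes dividing `n`" (p. 93, used from p. 80 on).
[cite: Aoki1999, §2 p. 80, Thm. 6.1 p. 93] -/
def sOneSet (n : ℕ) : Finset ℕ := (sSet n).filter fun p => p ≠ 2

/-- `S₂ = S₁ ∖ T` (Theorem 2.2, p. 81). [cite: Aoki1999, Thm. 2.2 p. 81] -/
def sTwoSet (n : ℕ) : Finset ℕ := sOneSet n \ tSet n

/-! ### §3 The matrix `Λ_{X,Y}` and the Gram matrix of Theorem 2.2 -/

/-- `Λ_{X,Y} = (λ_{q_j}(p_i))_{i, j}` (p. 79–80), rows indexed by the primes of `X`, columns by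
those of `Y`. [cite: Aoki1999, §2 pp. 79–80] -/
def lamMatrix (n : ℕ) (X Y : Finset ℕ) : Matrix X Y (ZMod 2) :=
  Matrix.of fun i j => lam n (j : ℕ) ((i : ℕ) : ℤ)

/-- **The Gram matrix of the pairing `( , )_V` on `V = V_{S₁}` in the basis of the primes of `S₁`**,
typed from the explicit entry formula displayed in the proof of Theorem 2.2 (p. 98):
`(p, q)_V = Σ_{l ∈ S₂} λ_l(p)λ_l(q) + δ_{p,q} λ₂(p) + ν{λ₂(p)ε₂(q) + ε₂(p)λ₂(q)}` — the sum over `S₂` is the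
`ᵗΛΛ`-term, `δ_{p,q}λ₂(p)` the diagonal matrix `Δ_{S₁}`, and the `ν`-term the symmetric matrix `νΩ_{S₁}`
(whose diagonal `ω_{pp} = 0` is automatic here: `2λ₂(p)ε₂(p) = 0` in `ℤ/2ℤ`). Theorem 2.2 prints this
matrix as `ᵗΛ_{S₂,S₁}Λ_{S₂,S₁} + Δ_{S₁} + νΩ_{S₁}`; in the convention `Λ_{X,Y} = (λ_{q_j}(p_i))` of p. 80
the displayed entry is that of `Λ_{S₁,S₂}·ᵗΛ_{S₁,S₂}` (symbols AT the primes `l ∈ S₂` OF `p, q`, as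
Theorem 6.1 gives them), which differs from `ᵗΛ_{S₂,S₁}Λ_{S₂,S₁}` only by `λ_l(p) ↔ λ_p(l)` (equal unless
`l ≡ p ≡ 3 (mod 4)`); the p. 98 display is what the proof establishes and is typed here.
[cite: Aoki1999, Thm. 2.2 p. 81, proof p. 98 (the display `(p, q)_V`); Thm. 6.1 p. 93] -/
def gramMatrix (n : ℕ) : Matrix (sOneSet n) (sOneSet n) (ZMod 2) :=
  Matrix.of fun i j =>
    (∑ l : sTwoSet n, lam n (l : ℕ) ((i : ℕ) : ℤ) * lam n (l : ℕ) ((j : ℕ) : ℤ)) +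
      (if i = j then lam n 2 ((i : ℕ) : ℤ) else 0) +
      nu n * (lam n 2 ((i : ℕ) : ℤ) * epsTwo (j : ℕ) + epsTwo (i : ℕ) * lam n 2 ((j : ℕ) : ℤ))

/-! ### §4 The essential part `Sel₀^(φ′)(E′/ℚ)` through Theorem 4.1 -/

/-- The positive representative `x_w = ∏_{p ∈ S₁} p^{w_p}` of `w ∈ 𝔽₂^{S₁}` in `V_{S₁}` — the
inverse of the isomorphism `v_{S₁} : V_{S₁} → (ℤ/2ℤ)^{S₁}` of p. 80 (`U_{S₁}` = positive
`S₁`-units, p. 86). [cite: Aoki1999, §2 p. 80, §4 p. 86] -/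
def rep (n : ℕ) (w : sOneSet n → ZMod 2) : ℤ :=
  ∏ p : sOneSet n, ((p : ℕ) : ℤ) ^ (w p).val

/-- The printed 2-adic condition in the definition of `Sel₀^(φ′)(E′/ℚ)` (p. 80): `x ≡ 1 (mod 8)`
if `n ≡ ±1 (mod 8)`, `x ≡ ±1 (mod 8)` if `n ≡ ±5 (mod 8)`, `v₂(x) = 0` if `n ≡ ±2 (mod 8)` (for a
square-free `n` these are all the cases). [cite: Aoki1999, §2 p. 80] -/
def essentialCond (n : ℕ) (x : ℤ) : Prop :=
  if n % 8 = 1 ∨ n % 8 = 7 then x % 8 = 1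
  else if n % 8 = 3 ∨ n % 8 = 5 then x % 8 = 1 ∨ x % 8 = 7
  else ¬ (2 : ℤ) ∣ x

/-- `v_{S₁}(Sel₀^(φ′)(E′/ℚ)) ⊆ 𝔽₂^{S₁}` (p. 80, with Theorem 4.1 p. 87 for the membership
"`x ∈ S^(φ′)(E′/ℚ)`" of a positive `x`: `λ_q(x) = 0` for all `q ∈ T`): the `w` whose representative
`x_w` lies in `ker λ_{S,T}` and satisfies the printed 2-adic condition.
[cite: Aoki1999, §2 p. 80, Thm. 4.1 p. 87] -/
def essential (n : ℕ) : Finset (sOneSet n → ZMod 2) :=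
  Finset.univ.filter fun w =>
    (∀ q ∈ tSet n, lam n q (rep n w) = 0) ∧ essentialCond n (rep n w)

/-- The Gram matrix `(wᵀ G w′)_{w, w′}` of `G = ᵗΛ_{S₂,S₁}Λ_{S₂,S₁} + Δ_{S₁} + νΩ_{S₁}` on all
elements of `v_{S₁}(Sel₀^(φ′)(E′/ℚ))`; its rank is the printed `rank ᵗΦ G Φ` for any basis `Φ`
(module docstring, substitution 2). [cite: Aoki1999, Thm. 2.2 p. 81, proof p. 98] -/
def gramEssential (n : ℕ) : Matrix (essential n) (essential n) (ZMod 2) :=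
  Matrix.of fun w w' =>
    (w : sOneSet n → ZMod 2) ⬝ᵥ (gramMatrix n).mulVec (w' : sOneSet n → ZMod 2)

/-- The right-hand side of Theorem 2.2:
`1 + |S| + |T| − 2 rank Λ_{S,T} − rank ᵗΦ(ᵗΛ_{S₂,S₁}Λ_{S₂,S₁} + Δ_{S₁} + νΩ_{S₁})Φ` (p. 81), as an
integer. [cite: Aoki1999, Thm. 2.2 p. 81] -/
def selmerDimFormula (n : ℕ) : ℤ :=
  1 + ((sSet n).card : ℤ) + ((tSet n).card : ℤ) -
    2 * ((lamMatrix n (sSet n) (tSet n)).rank : ℤ) - ((gramEssential n).rank : ℤ)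

/-! ### §5 The named fact (Theorem 2.2; nothing asserted) -/

/-- **Aoki 1999, Theorem 2.2** (p. 81, verbatim in the module docstring; proof §7 pp. 97–98 from
Theorems 2.1/4.1, 6.1 and Propositions 7.1/7.2), in the range `n ≡ 3, 6, 7 (mod 8)` of Theorem 6.1
(the range in which the proof applies the displayed pairing formula to `n` itself; for the other
residues the paper passes to `−n`, "`E′^(n) = E′^(−n)`", which changes the symbols `λ_p = {−n, ·}_p` —
TODO(general form)): for every positive square-free `n ≡ 3, 6, 7 (mod 8)`,
`dim_{𝔽₂} Sel^(2)(E^(n)/ℚ) = 1 + |S| + |T| − 2 rank Λ_{S,T} − rank ᵗΦ(ᵗΛ_{S₂,S₁}Λ_{S₂,S₁} + Δ_{S₁} + νΩ_{S₁})Φ`,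
where `E^(n) : y² = x³ − n²x = congruentNumberCurve n`, `Sel^(2)` is the tree's `2`-Selmer group
over `ℚ`, and the right-hand side is `selmerDimFormula n` (the Gram matrix typed from the p. 98
display, `Sel₀^(φ′)` read through Theorem 4.1, the rank of the restricted form taken over all of
`v_{S₁}(Sel₀)`; module docstring). Rendered as: `#Sel^(2)(E^(n)/ℚ) = 2^d` with `d = selmerDimFormula n`.
A THEOREM in print (refereed, complete proofs), vendored as a named fact; no `_holds` expected.
[cite: Aoki1999, Thm. 2.2 p. 81 and its proof p. 98; Thm. 4.1 p. 87; Thm. 6.1 p. 93] -/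
def thm22_card_selmerGroup_two : Prop :=
  ∀ n : ℕ, 0 < n → Squarefree n → (n % 8 = 3 ∨ n % 8 = 6 ∨ n % 8 = 7) →
    ∃ d : ℕ, Nat.card ((congruentNumberCurve n).selmerGroup 2) = 2 ^ d ∧
      (d : ℤ) = selmerDimFormula n

/-! ### §6 Bookkeeping (proved): evaluation of `{a, b}_p` by Serre's explicit sign, bimultiplicativity -/

section Bit

variable {p : ℕ} [hp : Fact p.Prime]

/-- `{a, b}_p` on non-zero integers through Serre's explicit local sign `localSign p a b`
(`hilbertSymbol_padic_intCast`). [cite: Serre1973, Ch. III §1.2 Thm. 1] -/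
theorem hilbertBit_eq_of_localSign {a b : ℤ} (ha : a ≠ 0) (hb : b ≠ 0) :
    hilbertBit p a b = if localSign p a b = 1 then 0 else 1 := by
  unfold hilbertBit
  rw [hilbertSymbol_padic_intCast p ha hb]

/-- `{a, b}_p = 0` iff `(a, b)_p = 1` (non-zero integers). [cite: Serre1973, Ch. III §1.2 Thm. 1] -/
theorem hilbertBit_eq_zero_iff {a b : ℤ} (ha : a ≠ 0) (hb : b ≠ 0) :
    hilbertBit p a b = 0 ↔ localSign p a b = 1 := by
  rw [hilbertBit_eq_of_localSign ha hb]
  split_ifs with h <;> simp [h]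

/-- `{a, b}_p = 1` iff `(a, b)_p = −1` (non-zero integers). [cite: Serre1973, Ch. III §1.2 Thm. 1] -/
theorem hilbertBit_eq_one_iff {a b : ℤ} (ha : a ≠ 0) (hb : b ≠ 0) :
    hilbertBit p a b = 1 ↔ localSign p a b = -1 := by
  rw [hilbertBit_eq_of_localSign ha hb]
  rcases localSign_eq_one_or p ha hb with h | h <;> simp [h]

/-- The additive symbol is additive in its second argument on non-zero integers
(bimultiplicativity of the Hilbert symbol, Serre Ch. III Thm. 2). [cite: Serre1973, Ch. III §1.2 Thm. 2] -/
theorem hilbertBit_mul_right {a b b' : ℤ} (ha : a ≠ 0) (hb : b ≠ 0) (hb' : b' ≠ 0) :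
    hilbertBit p a (b * b') = hilbertBit p a b + hilbertBit p a b' := by
  rw [hilbertBit_eq_of_localSign ha (mul_ne_zero hb hb'), hilbertBit_eq_of_localSign ha hb,
    hilbertBit_eq_of_localSign ha hb', localSign_mul_right' ha hb hb']
  rcases localSign_eq_one_or p ha hb with h | h <;>
    rcases localSign_eq_one_or p ha hb' with h' | h'
  · simp [h, h']
  · simp [h, h']
  · simp [h, h']
  · simp only [h, h', mul_neg, neg_neg, mul_one, if_true]
    decide

/-- `{a, 1}_p = 0`. [cite: Serre1973, Ch. III §1.2 Thm. 2] -/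
theorem hilbertBit_one_right (a : ℤ) : hilbertBit p a 1 = 0 := by
  unfold hilbertBit
  rw [Int.cast_one, hilbertSymbol_one_right]
  simp

end Bit

section Lam

variable {n : ℕ}

/-- `λ_p(x) = {−n, x}_p` for an odd prime `p`. [cite: Aoki1999, §2 p. 79] -/
theorem lam_of_ne_two {p : ℕ} (hp : p.Prime) (h2 : p ≠ 2) (x : ℤ) :
    lam n p x = @hilbertBit p ⟨hp⟩ (-(n : ℤ)) x := by
  unfold lam
  rw [dif_pos hp, if_neg h2]

/-- `λ₂(x) = {2, x}_2`. [cite: Aoki1999, §2 p. 79] -/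
theorem lam_two (x : ℤ) : lam n 2 x = hilbertBit 2 2 x := by
  unfold lam
  rw [dif_pos Nat.prime_two, if_pos rfl]

/-- `λ_p(1) = 0`. [cite: Aoki1999, §2 p. 79] -/
theorem lam_one (p : ℕ) : lam n p 1 = 0 := by
  unfold lam
  split_ifs <;> simp [hilbertBit_one_right]

/-- `λ_p` is additive on non-zero integers (`n ≠ 0`). [cite: Aoki1999, §2 p. 79] -/
theorem lam_mul (hn : n ≠ 0) (p : ℕ) {x y : ℤ} (hx : x ≠ 0) (hy : y ≠ 0) :
    lam n p (x * y) = lam n p x + lam n p y := by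
  unfold lam
  split_ifs with hp h2
  · exact hilbertBit_mul_right (p := 2) two_ne_zero hx hy
  · exact @hilbertBit_mul_right p ⟨hp⟩ _ _ _ (neg_ne_zero.mpr (by exact_mod_cast hn)) hx hy
  · simp

/-- `λ_p(x^k) = k · λ_p(x)` for `x ≠ 0`. [cite: Aoki1999, §2 p. 79] -/
theorem lam_pow (hn : n ≠ 0) (p : ℕ) {x : ℤ} (hx : x ≠ 0) (k : ℕ) :
    lam n p (x ^ k) = (k : ZMod 2) * lam n p x := by
  induction k with
  | zero => simp [lam_one]
  | succ k ih =>
    rw [pow_succ, lam_mul hn p (pow_ne_zero k hx) hx, ih]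
    push_cast
    ring

/-- `λ_q(x_w) = Σ_{p ∈ S₁} w_p λ_q(p)`: the additive symbol of the representative of `w` is the
`𝔽₂`-linear combination of the symbols of the primes (`n ≠ 0`). [cite: Aoki1999, §2 p. 80] -/
theorem lam_rep (hn : n ≠ 0) (q : ℕ) (w : sOneSet n → ZMod 2) :
    lam n q (rep n w) = ∑ p : sOneSet n, w p * lam n q ((p : ℕ) : ℤ) := by
  unfold rep
  have hne : ∀ p : sOneSet n, ((p : ℕ) : ℤ) ^ (w p).val ≠ 0 := fun p =>
    pow_ne_zero _ (by exact_mod_cast (Nat.prime_of_mem_primeFactors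
      (Finset.mem_filter.mp p.2).1).ne_zero)
  have key : ∀ s : Finset (sOneSet n), lam n q (∏ p ∈ s, ((p : ℕ) : ℤ) ^ (w p).val) =
      ∑ p ∈ s, w p * lam n q ((p : ℕ) : ℤ) := by
    intro s
    induction s using Finset.induction_on with
    | empty => simp [lam_one]
    | insert a s ha ih =>
      rw [Finset.prod_insert ha, Finset.sum_insert ha,
        lam_mul hn q (hne a) (Finset.prod_ne_zero_iff.mpr fun p _ => hne p), ih,
        lam_pow hn q (by exact_mod_cast (Nat.prime_of_mem_primeFactors
          (Finset.mem_filter.mp a.2).1).ne_zero), ZMod.natCast_val, ZMod.cast_id', id]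
  exact key Finset.univ

end Lam

end Literature.NumberTheory.EllipticCurves.Aoki1999

end
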